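import Summits.BirchSwinnertonDyer.BirchSwinnertonDyer.Theorems.SchneiderFreeAdditiveX3LocalTowerTorsionFiniteOfUnitRoot
import Summits.BirchSwinnertonDyer.BirchSwinnertonDyer.Theorems.SchneiderFreeAdditiveX3OrdinaryLineCharacter
import Literature.NumberTheory.EllipticCurves.AnticyclotomicLocalNormResidueSymbolProofs
import HarnessLib

/-!
# The «moving-line» stubs of crux `LocalTowerTorsionFiniteX3` (stmt-BirchSwinnertonDyer-19546) from
# FILE 1 (`hunit`) and the CFT fact

Seat `bsd-schneider-door-c5` (cell `bsd-schneider-ideate`), gen 6; route `SchneiderFreeAdditiveX3`.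
The skeleton «moving-line» registered on the record r5 `LocalTowerTorsionFiniteX3` (P2 g10, rev 11,
0e845708683d) has three stubs: `stub_lineDatum_potMult` (landed modulo A41 by door-c2 g5,
`stub_lineDatum_potMult_of_tate`, p455665), `stub_lineDatum_gordTwo` and `stub_lineMover`. With the
(G-ord, `e = 2`) line-with-character chain in the tree (FILE 2 p457112, FILE 3 p457099, glue p457466;
FILE 1 = `hunit`, door-c6 g3), the two remaining stubs are COROLLARIES, signatures VERBATIM:

* `stub_lineDatum_gordTwo_of_unitRoot` — from `hunit` ALONE: the κ-free line datum `(C, τ)` on the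
  (G-ord, `e = 2`) cell is the hLine's `(C, τ)` (`hLine_gordTwo_of_rat` ∘ `hLineRat_gordTwo_of_unitRoot`;
  `τ`-stability is `D_𝔭`-stability);
* `stub_lineMover_of_CFT_of_unitRoot` — from the CFT fact (i) and `hunit`: an INFINITE line datum is
  moved by some element of the local anticyclotomic group `D_𝔭 ⊓ ker κ`, because otherwise it would
  lie in the fixed module, which is FINITE (Fin_v: `localTowerTorsionFiniteX3_of_CFT_of_unitRoot`).

Proofs only (no definition, no named fact, no `sorry`); `--supports` stmt-BirchSwinnertonDyer-19546;
closes nothing by itself; BSD is not advanced. References: [JetchevSkinnerWan2017] §3.3 Prop. 3.3.4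
Case 3(b), Remark 3.3.5 (arXiv:1512.06894 p. 13); [GreenbergLNM1716] §2 pp. 69–70, §3 Lemma 3.3.
-/

noncomputable section

open scoped Classical

namespace Summit.BirchSwinnertonDyer.BirchSwinnertonDyer.Theorems.SchneiderFreeAdditiveX3

open NumberField IsDedekindDomain Field WeierstrassCurve
  Literature.NumberTheory.EllipticCurves Literature.NumberTheory.EllipticCurves.GreenbergSelmer
  Literature.NumberTheory.GaloisRepresentations
  Literature.NumberTheory.EllipticCurves.Rank1Residual
  Summit.BirchSwinnertonDyer.Rank1Residual.X11b
  Summit.BirchSwinnertonDyer.Rank1Residual.X2.GreenbergVatsalReductionDatum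
  Summit.BirchSwinnertonDyer.BirchSwinnertonDyer.Theses.SchneiderFreeAdditiveX3

set_option linter.dupNamespace false

/-- **Registered stub `stub_lineDatum_gordTwo` of the «moving-line» skeleton (crux
`LocalTowerTorsionFiniteX3`, stmt-BirchSwinnertonDyer-19546) from FILE 1 alone** — signature verbatim
as conclusion: the κ-free line datum `(C, τ)` on the (G-ord, `e = 2`) cell at `(K, 𝔭)` is the line WITH
character of `hLine_gordTwo_of_rat (hLineRat_gordTwo_of_unitRoot hunit)` with its `−1` element `τ`
(`τ`-stability of `C` is a case of `D_𝔭`-stability). [cite: GreenbergLNM1716, §2 pp. 69–70]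
[cite: JetchevSkinnerWan2017, §3.3 Prop. 3.3.4 Case 3(b) (arXiv:1512.06894 p. 13)] -/
theorem stub_lineDatum_gordTwo_of_unitRoot
    (hunit : ∀ (p : ℕ) [Fact p.Prime] (v : HeightOneSpectrum (𝓞 ℚ))
      (hpv : ((p : ℕ) : 𝓞 ℚ) ∈ v.asIdeal) (V : WeierstrassCurve ℚ) [V.IsElliptic] [V.IsGloballyMinimal],
      GoodOrd V p → ∀ (hΔ : ¬ (p : ℤ) ∣ minimalDiscriminantInt V), ∃ (a : ℤ) (α : ℤ_[p]ˣ),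
      ((α : ℤ_[p])) ^ 2 = a * (α : ℤ_[p]) - p ∧
      ∀ (σ : absoluteGaloisGroup (v.adicCompletion ℚ)) (n : ℕ), IsFrobPow σ (n : ℤ) →
        ∀ (k : ℕ) (c : V.geomPrimaryTorsion p), c ∈ (reductionDatum V p hpv hΔ).plus → p ^ k • c = 0 →
          ∀ N : ℤ, ((N : ℤ_[p]) -
              ((GaloisRep.cyclotomicCharacter ℚ p (absGaloisRestrict ℚ (v.adicCompletion ℚ) σ) *
                (α⁻¹) ^ n : ℤ_[p]ˣ) : ℤ_[p]) ∈ (Ideal.span {(p : ℤ_[p]) ^ k} : Ideal ℤ_[p])) →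
            absGaloisRestrict ℚ (v.adicCompletion ℚ) σ • c = N • c) :
    ∀ (W : WeierstrassCurve ℚ) [W.IsElliptic] [W.IsGloballyMinimal] (p : ℕ) [Fact p.Prime],
      W.analyticRank = 1 → p ≠ 2 → Literature.NumberTheory.EllipticCurves.Rank1Residual.ClassX3 W p →
        Summit.BirchSwinnertonDyer.Rank1Residual.Additive.SubGordTwo W p →
        ∀ (K : Type) [Field K] [NumberField K],
          Literature.NumberTheory.EllipticCurves.IsImaginaryQuadratic K →
          Summit.BirchSwinnertonDyer.Rank1Residual.X11b.SplitsIn K p →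
          ∀ (𝔭 : IsDedekindDomain.HeightOneSpectrum (NumberField.RingOfIntegers K)),
            ((p : ℕ) : NumberField.RingOfIntegers K) ∈ 𝔭.asIdeal →
            ∃ (C : AddSubgroup ((W.baseChange K).geomPrimaryTorsion p)) (τ : Field.absoluteGaloisGroup K),
              τ ∈ Literature.NumberTheory.EllipticCurves.GreenbergSelmer.decomp 𝔭 ∧ (∀ c ∈ C, τ • c ∈ C) ∧
              (∀ m : ((W.baseChange K).geomPrimaryTorsion p), τ • m + m ∈ C) ∧
              Set.ncard {c : ((W.baseChange K).geomPrimaryTorsion p) | c ∈ C ∧ p • c = 0} ≤ p := by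
  intro W _ _ p _ hr hp2 hX hS K _ _ hK hsplit 𝔭 h𝔭
  obtain ⟨C, a, α, hCD, hC1, -, ⟨τ, hτD, hτ⟩, -, -⟩ :=
    hLine_gordTwo_of_rat (hLineRat_gordTwo_of_unitRoot hunit) W p hr hp2 hX hS K hK hsplit 𝔭 h𝔭
  exact ⟨C, τ, hτD, fun c hc ↦ hCD τ hτD c hc, hτ, hC1⟩

/-- **Registered stub `stub_lineMover` of the «moving-line» skeleton (crux `LocalTowerTorsionFiniteX3`,
stmt-BirchSwinnertonDyer-19546) from the CFT fact and FILE 1** — signature verbatim as conclusion: on the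
whole door (`SubSemistableTwist`), an INFINITE `C` from a line datum `(C, τ)` is moved by some element
of `D_𝔭 ⊓ ker κ` — otherwise `C` lies in the fixed module `E(K̄)[p^∞]^{D_𝔭 ⊓ ker κ}`, which is FINITE
(Fin_v from (i) the fact `ZpExtension.exists_isFrobPow_mem_kerSubgroup_of_isAnticyclotomic` and
`hunit`: `localTowerTorsionFiniteX3_of_CFT_of_unitRoot`). As registered (fact-free) the stub is
F2-class, like the record itself. [cite: JetchevSkinnerWan2017, §3.3 Prop. 3.3.4 Case 3(b), Remark 3.3.5 (arXiv:1512.06894 p. 13)]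
[cite: GreenbergLNM1716, §3 Lemma 3.3] -/
theorem stub_lineMover_of_CFT_of_unitRoot
    (hCFT : ∀ (K : Type) [Field K] [NumberField K] (p : ℕ) [Fact p.Prime],
      ZpExtension.exists_isFrobPow_mem_kerSubgroup_of_isAnticyclotomic K p)
    (hunit : ∀ (p : ℕ) [Fact p.Prime] (v : HeightOneSpectrum (𝓞 ℚ))
      (hpv : ((p : ℕ) : 𝓞 ℚ) ∈ v.asIdeal) (V : WeierstrassCurve ℚ) [V.IsElliptic] [V.IsGloballyMinimal],
      GoodOrd V p → ∀ (hΔ : ¬ (p : ℤ) ∣ minimalDiscriminantInt V), ∃ (a : ℤ) (α : ℤ_[p]ˣ),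
      ((α : ℤ_[p])) ^ 2 = a * (α : ℤ_[p]) - p ∧
      ∀ (σ : absoluteGaloisGroup (v.adicCompletion ℚ)) (n : ℕ), IsFrobPow σ (n : ℤ) →
        ∀ (k : ℕ) (c : V.geomPrimaryTorsion p), c ∈ (reductionDatum V p hpv hΔ).plus → p ^ k • c = 0 →
          ∀ N : ℤ, ((N : ℤ_[p]) -
              ((GaloisRep.cyclotomicCharacter ℚ p (absGaloisRestrict ℚ (v.adicCompletion ℚ) σ) *
                (α⁻¹) ^ n : ℤ_[p]ˣ) : ℤ_[p]) ∈ (Ideal.span {(p : ℤ_[p]) ^ k} : Ideal ℤ_[p])) →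
            absGaloisRestrict ℚ (v.adicCompletion ℚ) σ • c = N • c) :
    ∀ (W : WeierstrassCurve ℚ) [W.IsElliptic] [W.IsGloballyMinimal] (p : ℕ) [Fact p.Prime],
      W.analyticRank = 1 → p ≠ 2 → Literature.NumberTheory.EllipticCurves.Rank1Residual.ClassX3 W p →
        Summit.BirchSwinnertonDyer.Rank1Residual.Additive.SubSemistableTwist W p →
        ∀ (K : Type) [Field K] [NumberField K],
          Literature.NumberTheory.EllipticCurves.IsImaginaryQuadratic K →
          Summit.BirchSwinnertonDyer.Rank1Residual.X11b.SplitsIn K p →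
          ∀ (κ : Literature.NumberTheory.EllipticCurves.ZpExtension K p), κ.IsAnticyclotomic →
          ∀ (𝔭 : IsDedekindDomain.HeightOneSpectrum (NumberField.RingOfIntegers K)),
            ((p : ℕ) : NumberField.RingOfIntegers K) ∈ 𝔭.asIdeal →
            ∀ (C : AddSubgroup ((W.baseChange K).geomPrimaryTorsion p)) (τ : Field.absoluteGaloisGroup K),
              τ ∈ Literature.NumberTheory.EllipticCurves.GreenbergSelmer.decomp 𝔭 →
              (∀ c ∈ C, τ • c ∈ C) → (∀ m : ((W.baseChange K).geomPrimaryTorsion p), τ • m + m ∈ C) →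
              Set.ncard {c : ((W.baseChange K).geomPrimaryTorsion p) | c ∈ C ∧ p • c = 0} ≤ p →
              (C : Set ((W.baseChange K).geomPrimaryTorsion p)).Infinite →
              ∃ g ∈ Literature.NumberTheory.EllipticCurves.GreenbergSelmer.decomp 𝔭 ⊓ κ.kerSubgroup,
                ∃ c ∈ C, g • c ≠ c := by
  intro W _ _ p _ hr hp2 hX hS K _ _ hK hsplit κ hκ 𝔭 h𝔭 C τ _ _ _ _ hinf
  have hfin := localTowerTorsionFiniteX3_of_CFT_of_unitRoot hCFT hunit W p hr hp2 hX hS K hK hsplit κ hκ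
    𝔭 h𝔭
  by_contra hmove
  push Not at hmove
  refine hinf (hfin.subset fun c hc ↦ ?_)
  rw [SetLike.mem_coe, FixedPoints.mem_addSubgroup]
  intro g
  exact hmove g g.2 c hc

/-! ## Appended (gen 6, after FILE 1c `unitRootCharacter` landed, door-c6 g3 p-OrdinaryLineCharacter):
the stubs with `hunit` DISCHARGED -/

/-- **Registered stub `stub_lineDatum_gordTwo` of the «moving-line» skeleton of crux
`LocalTowerTorsionFiniteX3` (stmt-BirchSwinnertonDyer-19546) — UNCONDITIONAL, signature verbatim**:
`stub_lineDatum_gordTwo_of_unitRoot` with FILE 1 = door-c6 g3's `unitRootCharacter` (the unit-root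
Frobenius character of Greenberg's reduction line, `…OrdinaryLineCharacter`).
[cite: GreenbergLNM1716, §2 pp. 69–70] [cite: JetchevSkinnerWan2017, §3.3 Prop. 3.3.4 Case 3(b) (arXiv:1512.06894 p. 13)] -/
theorem stub_lineDatum_gordTwo :
    ∀ (W : WeierstrassCurve ℚ) [W.IsElliptic] [W.IsGloballyMinimal] (p : ℕ) [Fact p.Prime],
      W.analyticRank = 1 → p ≠ 2 → Literature.NumberTheory.EllipticCurves.Rank1Residual.ClassX3 W p →
        Summit.BirchSwinnertonDyer.Rank1Residual.Additive.SubGordTwo W p →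
        ∀ (K : Type) [Field K] [NumberField K],
          Literature.NumberTheory.EllipticCurves.IsImaginaryQuadratic K →
          Summit.BirchSwinnertonDyer.Rank1Residual.X11b.SplitsIn K p →
          ∀ (𝔭 : IsDedekindDomain.HeightOneSpectrum (NumberField.RingOfIntegers K)),
            ((p : ℕ) : NumberField.RingOfIntegers K) ∈ 𝔭.asIdeal →
            ∃ (C : AddSubgroup ((W.baseChange K).geomPrimaryTorsion p)) (τ : Field.absoluteGaloisGroup K),
              τ ∈ Literature.NumberTheory.EllipticCurves.GreenbergSelmer.decomp 𝔭 ∧ (∀ c ∈ C, τ • c ∈ C) ∧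
              (∀ m : ((W.baseChange K).geomPrimaryTorsion p), τ • m + m ∈ C) ∧
              Set.ncard {c : ((W.baseChange K).geomPrimaryTorsion p) | c ∈ C ∧ p • c = 0} ≤ p :=
  stub_lineDatum_gordTwo_of_unitRoot unitRootCharacter

/-- **Registered stub `stub_lineMover` of the «moving-line» skeleton of crux `LocalTowerTorsionFiniteX3`
(stmt-BirchSwinnertonDyer-19546) from the CFT fact ALONE** — signature verbatim as conclusion:
`stub_lineMover_of_CFT_of_unitRoot` with FILE 1 = `unitRootCharacter`. The fact-free registered form is
F2-class (it is the Fin_v record on frames with a line datum); this is its provable F-typed form.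
[cite: JetchevSkinnerWan2017, §3.3 Prop. 3.3.4 Case 3(b), Remark 3.3.5 (arXiv:1512.06894 p. 13)] -/
theorem stub_lineMover_of_CFT
    (hCFT : ∀ (K : Type) [Field K] [NumberField K] (p : ℕ) [Fact p.Prime],
      ZpExtension.exists_isFrobPow_mem_kerSubgroup_of_isAnticyclotomic K p) :
    ∀ (W : WeierstrassCurve ℚ) [W.IsElliptic] [W.IsGloballyMinimal] (p : ℕ) [Fact p.Prime],
      W.analyticRank = 1 → p ≠ 2 → Literature.NumberTheory.EllipticCurves.Rank1Residual.ClassX3 W p →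
        Summit.BirchSwinnertonDyer.Rank1Residual.Additive.SubSemistableTwist W p →
        ∀ (K : Type) [Field K] [NumberField K],
          Literature.NumberTheory.EllipticCurves.IsImaginaryQuadratic K →
          Summit.BirchSwinnertonDyer.Rank1Residual.X11b.SplitsIn K p →
          ∀ (κ : Literature.NumberTheory.EllipticCurves.ZpExtension K p), κ.IsAnticyclotomic →
          ∀ (𝔭 : IsDedekindDomain.HeightOneSpectrum (NumberField.RingOfIntegers K)),
            ((p : ℕ) : NumberField.RingOfIntegers K) ∈ 𝔭.asIdeal →
            ∀ (C : AddSubgroup ((W.baseChange K).geomPrimaryTorsion p)) (τ : Field.absoluteGaloisGroup K),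
              τ ∈ Literature.NumberTheory.EllipticCurves.GreenbergSelmer.decomp 𝔭 →
              (∀ c ∈ C, τ • c ∈ C) → (∀ m : ((W.baseChange K).geomPrimaryTorsion p), τ • m + m ∈ C) →
              Set.ncard {c : ((W.baseChange K).geomPrimaryTorsion p) | c ∈ C ∧ p • c = 0} ≤ p →
              (C : Set ((W.baseChange K).geomPrimaryTorsion p)).Infinite →
              ∃ g ∈ Literature.NumberTheory.EllipticCurves.GreenbergSelmer.decomp 𝔭 ⊓ κ.kerSubgroup,
                ∃ c ∈ C, g • c ≠ c :=
  stub_lineMover_of_CFT_of_unitRoot hCFT unitRootCharacter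

/-- **The REGISTERED moving-line stub `stub_lineMover` of crux 19546, UNCONDITIONAL, signature VERBATIM**
(gen 7 append, 2026-08-26): the cite-only local-class-field-theory fact
`ZpExtension.exists_isFrobPow_mem_kerSubgroup_of_isAnticyclotomic` (door-c5 g5, p443291) is a THEOREM of
the tree since door-c4 g6's `…_holds` (p470246, `AnticyclotomicLocalNormResidueSymbolProofs.lean`), so the
F-typed form `stub_lineMover_of_CFT` above discharges: on the door's cells, an INFINITE `decomp 𝔭`-stable line
with `#C[p] ≤ p` and a `−1`-element cannot sit inside the fixed module of `decomp 𝔭 ⊓ ker κ` — some element of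
the local anticyclotomic Galois group MOVES it. With `stub_lineDatum_gordTwo` (above) and door-c2 g5's
`stub_lineDatum_potMult_of_tate` (A41 `_holds`), all three stubs of the «moving-line» skeleton (P2 g10,
0e845708) are now unconditional theorems, like the crux itself (19546 CLOSED by door-c4 g6, p470355).
[cite: JetchevSkinnerWan2017, §3.3 Prop. 3.3.4 Case 3(b), Remark 3.3.5 (arXiv:1512.06894 p. 13)] -/
theorem stub_lineMover :
    ∀ (W : WeierstrassCurve ℚ) [W.IsElliptic] [W.IsGloballyMinimal] (p : ℕ) [Fact p.Prime],
      W.analyticRank = 1 → p ≠ 2 → Literature.NumberTheory.EllipticCurves.Rank1Residual.ClassX3 W p →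
        Summit.BirchSwinnertonDyer.Rank1Residual.Additive.SubSemistableTwist W p →
        ∀ (K : Type) [Field K] [NumberField K],
          Literature.NumberTheory.EllipticCurves.IsImaginaryQuadratic K →
          Summit.BirchSwinnertonDyer.Rank1Residual.X11b.SplitsIn K p →
          ∀ (κ : Literature.NumberTheory.EllipticCurves.ZpExtension K p), κ.IsAnticyclotomic →
          ∀ (𝔭 : IsDedekindDomain.HeightOneSpectrum (NumberField.RingOfIntegers K)),
            ((p : ℕ) : NumberField.RingOfIntegers K) ∈ 𝔭.asIdeal →
            ∀ (C : AddSubgroup ((W.baseChange K).geomPrimaryTorsion p)) (τ : Field.absoluteGaloisGroup K),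
              τ ∈ Literature.NumberTheory.EllipticCurves.GreenbergSelmer.decomp 𝔭 →
              (∀ c ∈ C, τ • c ∈ C) → (∀ m : ((W.baseChange K).geomPrimaryTorsion p), τ • m + m ∈ C) →
              Set.ncard {c : ((W.baseChange K).geomPrimaryTorsion p) | c ∈ C ∧ p • c = 0} ≤ p →
              (C : Set ((W.baseChange K).geomPrimaryTorsion p)).Infinite →
              ∃ g ∈ Literature.NumberTheory.EllipticCurves.GreenbergSelmer.decomp 𝔭 ⊓ κ.kerSubgroup,
                ∃ c ∈ C, g • c ≠ c :=
  stub_lineMover_of_CFT fun K _ _ p _ ↦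
    Literature.NumberTheory.EllipticCurves.ZpExtension.exists_isFrobPow_mem_kerSubgroup_of_isAnticyclotomic_holds
      K p

end Summit.BirchSwinnertonDyer.BirchSwinnertonDyer.Theorems.SchneiderFreeAdditiveX3

end
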